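import Mathlib
import Summits.AtomisticToContinuum.FouriersLaw.Theses.EmbeddedDrudeMourre
import Summits.AtomisticToContinuum.FouriersLaw.Theorems.EmbeddedDrudeMourreDrudeDissolutionStubExcursionSecondDifferenceGradientFloorFar
import Literature.MathematicalPhysics.KineticTheory.PhononPairBand
import HarnessLib

/-!
# Geometry of the free pair resonance for stub B1b″ of line `kinetic-polymer-gas-on-the-time-axis`:
# the Morse gradient floor at the two extremal critical points of `Ω` — auxiliary lemmas
(crux `EmbeddedDrudeMourre.DrudeDissolution`, item stmt-AtomisticToContinuum-12593; `--supports` file, closes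
nothing; lead c13, sub-goal M5b-corner of the B1b″ plan)

WHAT (this file: the algebraic core, the Taylor control of the group velocity at the band edges — registered
sub-goal `groupVelocity_taylor_edges` —, and the coordinate partials of `Ω`; the floor itself is assembled in
`…GradientFloorCorner.lean`). `resonanceFn_gradient_floor_corner`: for `ω₂ > 0` there are `r, c > 0` such that, with `Ω` read at
`p = (k₁,(k₃,k₂))`, `‖DΩ(p)‖ ≥ c·‖p − p₀‖` whenever `‖p − p₀‖ < r`, for every `2πℤ³`-translate `p₀` of the two
extremal critical points `(k₁,k₂,k₃) = (0,0,π)` (global minimum `−2(ω(π)−ω(0))`) and `(π,π,0)` (global maximum) —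
i.e. the two isolated critical points of `Ω` are NON-DEGENERATE (Morse), with the explicit constant
`c = 1/(6 ω(π)) = 1/(6√(ω₂+4))`. With `resonanceFn_gradient_floor_far` (the bulk) this leaves only the co-moving
curves in the exchange planes (Morse–Bott, M5b-curve) for the gradient-floor input of the second-difference estimate.

HOW. Near `(0,0,π)` write `(k₁,k₂,k₃) = (a, b, π+c)`; the group velocity satisfies `v(x) = x/ω(0) + o(x)` and
`v(π+x) = −x/ω(π) + o(x)` (`hasDerivAt_groupVelocity` at `0` and `π`), so the three partials of `Ω` are
`a/ω₀ + (a+b−c)/ω_π`, `b/ω₀ + (a+b−c)/ω_π`, `(2c−a−b)/ω_π` up to `ε(|a|+|b|+|c|)`; pairing with `(a,b,c)` gives the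
Hessian form `(a²+b²)/ω₀ + ((a+b−c)² + c²)/ω_π ≥ (a²+b²+c²)/ω_π`, whence `max|∂ⱼΩ| ≥ ‖(a,b,c)‖_∞/(6ω_π)` once
`18ε ≤ 1/ω_π` (`corner_floor_alg`); the corner `(π,π,0)` is the same computation with `ω₀ ↔ ω_π` and all signs
flipped. Periodicity (`fderiv_resonanceFn₃_add_int_mul`) moves `p₀` to any `2πℤ³`-translate.
-/

noncomputable section

open Set Real Topology Filter Asymptotics
open Literature.MathematicalPhysics.KineticTheory
open Literature.MathematicalPhysics.KineticTheory.PhononBoltzmann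

namespace Summit.AtomisticToContinuum.FouriersLaw.Theorems.DrudeDissolution.KineticPolymerGasOnTheTimeAxis

/-! ### The algebraic core: a positive-definite Hessian gives a linear gradient floor -/

/-- `max(|a|,|b|,|c|)² ≤ a² + b² + c²`. [folklore] -/
theorem max_abs_sq_le_sum_sq (a b c : ℝ) : (max |a| (max |b| |c|)) ^ 2 ≤ a ^ 2 + b ^ 2 + c ^ 2 := by
  have ha := sq_abs a
  have hb := sq_abs b
  have hc := sq_abs c
  rcases max_cases |a| (max |b| |c|) with ⟨h, -⟩ | ⟨h, -⟩
  · rw [h, ha]; nlinarith [sq_nonneg b, sq_nonneg c]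
  · rw [h]
    rcases max_cases |b| |c| with ⟨h', -⟩ | ⟨h', -⟩
    · rw [h', hb]; nlinarith [sq_nonneg a, sq_nonneg c]
    · rw [h', hc]; nlinarith [sq_nonneg a, sq_nonneg b]

/-- **Algebraic core of the Morse floor.** If `d₁, d₂, d₃` are within `ε(|a|+|b|+|c|)` of the linear forms
`αa + β(a+b−c)`, `αb + β(a+b−c)`, `β(2c−a−b)` (`α, β > 0`, `18ε ≤ min α β`), then
`max(|d₁|,|d₂|,|d₃|) ≥ (min α β/6)·max(|a|,|b|,|c|)`: pairing with `(a,b,c)` produces the positive-definite form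
`α(a²+b²) + β((a+b−c)² + c²) ≥ min(α,β)(a²+b²+c²)`. [folklore] -/
theorem corner_floor_alg {α β ε a b c d₁ d₂ d₃ : ℝ} (hα : 0 < α) (hβ : 0 < β)
    (hε0 : 0 ≤ ε) (hε : 18 * ε ≤ min α β)
    (h1 : |d₁ - (α * a + β * (a + b - c))| ≤ ε * (|a| + |b| + |c|))
    (h2 : |d₂ - (α * b + β * (a + b - c))| ≤ ε * (|a| + |b| + |c|))
    (h3 : |d₃ - β * (2 * c - a - b)| ≤ ε * (|a| + |b| + |c|)) :
    min α β / 6 * max |a| (max |b| |c|) ≤ max |d₁| (max |d₂| |d₃|) := by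
  -- abbreviations (plain `have`s with defining equations)
  obtain ⟨m, hm⟩ : ∃ m, m = min α β := ⟨_, rfl⟩
  obtain ⟨M, hM⟩ : ∃ M, M = max |a| (max |b| |c|) := ⟨_, rfl⟩
  obtain ⟨D, hD⟩ : ∃ D, D = max |d₁| (max |d₂| |d₃|) := ⟨_, rfl⟩
  obtain ⟨s, hs⟩ : ∃ s, s = |a| + |b| + |c| := ⟨_, rfl⟩
  rw [← hm, ← hM, ← hD]
  rw [← hm] at hε
  rw [← hs] at h1 h2 h3
  have hmpos : 0 < m := by rw [hm]; exact lt_min hα hβ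
  have hmα : m ≤ α := by rw [hm]; exact min_le_left _ _
  have hmβ : m ≤ β := by rw [hm]; exact min_le_right _ _
  have haM : |a| ≤ M := by rw [hM]; exact le_max_left _ _
  have hbM : |b| ≤ M := by rw [hM]; exact (le_max_left _ _).trans (le_max_right _ _)
  have hcM : |c| ≤ M := by rw [hM]; exact (le_max_right _ _).trans (le_max_right _ _)
  have hM0 : 0 ≤ M := (abs_nonneg a).trans haM
  have hD1 : |d₁| ≤ D := by rw [hD]; exact le_max_left _ _
  have hD2 : |d₂| ≤ D := by rw [hD]; exact (le_max_left _ _).trans (le_max_right _ _)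
  have hD3 : |d₃| ≤ D := by rw [hD]; exact (le_max_right _ _).trans (le_max_right _ _)
  have hD0 : 0 ≤ D := (abs_nonneg d₁).trans hD1
  have hs0 : 0 ≤ s := by rw [hs]; positivity
  have hsM : s ≤ 3 * M := by rw [hs]; linarith
  -- the pairing `Q = a d₁ + b d₂ + c d₃` versus its linear model `Q₀`
  have hQlow : α * a ^ 2 + α * b ^ 2 + β * (a + b - c) ^ 2 + β * c ^ 2 - ε * s ^ 2 ≤
      a * d₁ + b * d₂ + c * d₃ := by
    have e : a * d₁ + b * d₂ + c * d₃ - (α * a ^ 2 + α * b ^ 2 + β * (a + b - c) ^ 2 + β * c ^ 2) =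
        a * (d₁ - (α * a + β * (a + b - c))) + b * (d₂ - (α * b + β * (a + b - c))) +
          c * (d₃ - β * (2 * c - a - b)) := by ring
    have t1 : |a * (d₁ - (α * a + β * (a + b - c)))| ≤ |a| * (ε * s) := by
      rw [abs_mul]; exact mul_le_mul_of_nonneg_left h1 (abs_nonneg _)
    have t2 : |b * (d₂ - (α * b + β * (a + b - c)))| ≤ |b| * (ε * s) := by
      rw [abs_mul]; exact mul_le_mul_of_nonneg_left h2 (abs_nonneg _)
    have t3 : |c * (d₃ - β * (2 * c - a - b))| ≤ |c| * (ε * s) := by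
      rw [abs_mul]; exact mul_le_mul_of_nonneg_left h3 (abs_nonneg _)
    have hsum : |a * d₁ + b * d₂ + c * d₃ -
        (α * a ^ 2 + α * b ^ 2 + β * (a + b - c) ^ 2 + β * c ^ 2)| ≤ ε * s ^ 2 := by
      rw [e]
      calc |a * (d₁ - (α * a + β * (a + b - c))) + b * (d₂ - (α * b + β * (a + b - c))) +
            c * (d₃ - β * (2 * c - a - b))|
          ≤ |a * (d₁ - (α * a + β * (a + b - c)))| + |b * (d₂ - (α * b + β * (a + b - c)))| +
            |c * (d₃ - β * (2 * c - a - b))| := abs_add_three _ _ _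
        _ ≤ |a| * (ε * s) + |b| * (ε * s) + |c| * (ε * s) := add_le_add (add_le_add t1 t2) t3
        _ = ε * s ^ 2 := by rw [hs]; ring
    have := (abs_le.1 hsum).1
    linarith
  -- the model is positive definite: `≥ m (a²+b²+c²) ≥ m M²`
  have hsq : M ^ 2 ≤ a ^ 2 + b ^ 2 + c ^ 2 := by rw [hM]; exact max_abs_sq_le_sum_sq a b c
  have p1 : m * a ^ 2 ≤ α * a ^ 2 := mul_le_mul_of_nonneg_right hmα (sq_nonneg _)
  have p2 : m * b ^ 2 ≤ α * b ^ 2 := mul_le_mul_of_nonneg_right hmα (sq_nonneg _)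
  have p3 : m * c ^ 2 ≤ β * c ^ 2 := mul_le_mul_of_nonneg_right hmβ (sq_nonneg _)
  have p4 : 0 ≤ β * (a + b - c) ^ 2 := by positivity
  have p5 : m * M ^ 2 ≤ m * (a ^ 2 + b ^ 2 + c ^ 2) := mul_le_mul_of_nonneg_left hsq hmpos.le
  have hmodel : m * M ^ 2 ≤ α * a ^ 2 + α * b ^ 2 + β * (a + b - c) ^ 2 + β * c ^ 2 := by linarith
  -- the pairing is at most `s D ≤ 3 M D`
  have hQup : a * d₁ + b * d₂ + c * d₃ ≤ 3 * M * D := by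
    have t1 : a * d₁ ≤ |a| * D :=
      (le_abs_self _).trans ((abs_mul a d₁).le.trans (mul_le_mul_of_nonneg_left hD1 (abs_nonneg _)))
    have t2 : b * d₂ ≤ |b| * D :=
      (le_abs_self _).trans ((abs_mul b d₂).le.trans (mul_le_mul_of_nonneg_left hD2 (abs_nonneg _)))
    have t3 : c * d₃ ≤ |c| * D :=
      (le_abs_self _).trans ((abs_mul c d₃).le.trans (mul_le_mul_of_nonneg_left hD3 (abs_nonneg _)))
    have t4 : (|a| + |b| + |c|) * D ≤ 3 * M * D := mul_le_mul_of_nonneg_right (by linarith) hD0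
    linarith
  -- the Taylor error is at most `9 ε M² ≤ (m/2) M²`
  have herr : ε * s ^ 2 ≤ m / 2 * M ^ 2 := by
    have h9 : s ^ 2 ≤ (3 * M) ^ 2 := pow_le_pow_left₀ hs0 hsM 2
    have h9' : ε * s ^ 2 ≤ ε * (3 * M) ^ 2 := mul_le_mul_of_nonneg_left h9 hε0
    have h18 : ε * (3 * M) ^ 2 ≤ m / 2 * M ^ 2 := by
      rw [show ε * (3 * M) ^ 2 = (9 * ε) * M ^ 2 by ring]
      exact mul_le_mul_of_nonneg_right (by linarith) (sq_nonneg _)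
    exact h9'.trans h18
  have hkey : m / 2 * M ^ 2 ≤ 3 * M * D := by linarith
  -- divide by `M` (the case `M = 0` is trivial)
  rcases eq_or_lt_of_le hM0 with hM00 | hMpos
  · rw [← hM00, mul_zero]; exact hD0
  · have h : (m / 2 * M) * M ≤ (3 * D) * M := by
      rw [show (m / 2 * M) * M = m / 2 * M ^ 2 by ring, show (3 * D) * M = 3 * M * D by ring]
      exact hkey
    have := le_of_mul_le_mul_right h hMpos
    linarith

/-! ### The first-order Taylor control of the group velocity at `0` and at `π` -/

/-- `v(0) = 0` and `v(π) = 0`. [folklore] -/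
theorem groupVelocity_zero_pi (ω₂ : ℝ) : groupVelocity ω₂ 0 = 0 ∧ groupVelocity ω₂ Real.pi = 0 := by
  constructor <;> simp [groupVelocity]

/-- **Registered sub-goal `groupVelocity_taylor_edges`: Taylor control of `v` at the band edges.** For `ω₂ > 0` and `ε > 0` there is `δ > 0` with
`|v(x) − x/ω(0)| ≤ ε|x|` and `|v(π + x) + x/ω(π)| ≤ ε|x|` for `|x| < δ` (`v′(0) = 1/ω(0)`, `v′(π) = −1/ω(π)`).
[folklore] -/
theorem groupVelocity_taylor_edges :
    ∀ {ω₂ : ℝ}, 0 < ω₂ → ∀ {ε : ℝ}, 0 < ε → ∃ δ : ℝ, 0 < δ ∧ ∀ x : ℝ, |x| < δ →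
      |groupVelocity ω₂ x - x / dispersion ω₂ 0| ≤ ε * |x| ∧
        |groupVelocity ω₂ (Real.pi + x) + x / dispersion ω₂ Real.pi| ≤ ε * |x| := by
  intro ω₂ hω ε hε
  have hd0 := dispersion_pos hω 0
  have hdπ := dispersion_pos hω Real.pi
  obtain ⟨hv0, hvπ⟩ := groupVelocity_zero_pi ω₂
  -- the derivatives at `0` and at `π`
  have hD0 : HasDerivAt (groupVelocity ω₂) (1 / dispersion ω₂ 0) 0 := by
    have h := hasDerivAt_groupVelocity hω 0
    refine h.congr_deriv ?_
    rw [Real.cos_zero, Real.sin_zero]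
    field_simp
    ring
  have hDπ : HasDerivAt (groupVelocity ω₂) (-(1 / dispersion ω₂ Real.pi)) Real.pi := by
    have h := hasDerivAt_groupVelocity hω Real.pi
    refine h.congr_deriv ?_
    rw [Real.cos_pi, Real.sin_pi]
    field_simp
    ring
  -- little-o at `0`
  have ho0 := (hasDerivAt_iff_isLittleO.1 hD0).def hε
  rw [hv0] at ho0
  obtain ⟨δ₀, hδ₀, h0⟩ := Metric.eventually_nhds_iff.1 ho0
  -- little-o at `π`
  have hoπ := (hasDerivAt_iff_isLittleO.1 hDπ).def hε
  rw [hvπ] at hoπ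
  obtain ⟨δ₁, hδ₁, hπ⟩ := Metric.eventually_nhds_iff.1 hoπ
  refine ⟨min δ₀ δ₁, lt_min hδ₀ hδ₁, fun x hx => ⟨?_, ?_⟩⟩
  · have hx0 : dist x 0 < δ₀ := by
      rw [Real.dist_eq, sub_zero]; exact lt_of_lt_of_le hx (min_le_left _ _)
    have h := h0 hx0
    simp only [sub_zero, smul_eq_mul, Real.norm_eq_abs] at h
    have e : groupVelocity ω₂ x - x * (1 / dispersion ω₂ 0) = groupVelocity ω₂ x - x / dispersion ω₂ 0 := by
      ring
    rw [e] at h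
    exact h
  · have hxπ : dist (Real.pi + x) Real.pi < δ₁ := by
      rw [Real.dist_eq, show Real.pi + x - Real.pi = x by ring]
      exact lt_of_lt_of_le hx (min_le_right _ _)
    have h := hπ hxπ
    simp only [sub_zero, smul_eq_mul, Real.norm_eq_abs, show Real.pi + x - Real.pi = x by ring] at h
    have e : groupVelocity ω₂ (Real.pi + x) - x * -(1 / dispersion ω₂ Real.pi) =
        groupVelocity ω₂ (Real.pi + x) + x / dispersion ω₂ Real.pi := by ring
    rw [e] at h
    exact h

/-! ### The partial derivatives of `Ω` as evaluations of its Fréchet derivative -/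

/-- The three partial derivatives of `p = (k₁,(k₃,k₂)) ↦ Ω(k₁,k₂,k₃)`: `∂/∂k₁ = v₁ − v₄`, `∂/∂k₃ = v₄ − v₃`,
`∂/∂k₂ = v₂ − v₄` (`k₄ = k₁ + k₂ − k₃`). [folklore] -/
theorem fderiv_resonanceFn₃_apply_basis {ω₂ : ℝ} (hω : 0 < ω₂) (p : ℝ × ℝ × ℝ) :
    fderiv ℝ (fun q : ℝ × ℝ × ℝ => resonanceFn ω₂ q.1 q.2.2 q.2.1) p (1, 0, 0) =
        groupVelocity ω₂ p.1 - groupVelocity ω₂ (p.1 + p.2.2 - p.2.1) ∧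
      fderiv ℝ (fun q : ℝ × ℝ × ℝ => resonanceFn ω₂ q.1 q.2.2 q.2.1) p (0, 1, 0) =
        groupVelocity ω₂ (p.1 + p.2.2 - p.2.1) - groupVelocity ω₂ p.2.1 ∧
      fderiv ℝ (fun q : ℝ × ℝ × ℝ => resonanceFn ω₂ q.1 q.2.2 q.2.1) p (0, 0, 1) =
        groupVelocity ω₂ p.2.2 - groupVelocity ω₂ (p.1 + p.2.2 - p.2.1) := by
  have h := (MourreDissolution.contAsm_hasFDerivAt_resonanceFn hω p).fderiv
  rw [h]
  simp only [add_apply, sub_apply, smul_apply, ContinuousLinearMap.comp_apply,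
    ContinuousLinearMap.coe_fst', ContinuousLinearMap.coe_snd', smul_eq_mul, mul_one, mul_zero,
    add_zero, sub_zero, zero_add, zero_sub, true_and, and_true]
  ring

/-- Each coordinate evaluation is bounded by the operator norm (the basis vectors have sup norm `1`). [folklore] -/
theorem abs_fderiv_apply_basis_le (L : ℝ × ℝ × ℝ →L[ℝ] ℝ) :
    |L (1, 0, 0)| ≤ ‖L‖ ∧ |L (0, 1, 0)| ≤ ‖L‖ ∧ |L (0, 0, 1)| ≤ ‖L‖ := by
  have n1 : ‖((1 : ℝ), (0 : ℝ), (0 : ℝ))‖ = 1 := by simp [Prod.norm_def]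
  have n2 : ‖((0 : ℝ), (1 : ℝ), (0 : ℝ))‖ = 1 := by simp [Prod.norm_def]
  have n3 : ‖((0 : ℝ), (0 : ℝ), (1 : ℝ))‖ = 1 := by simp [Prod.norm_def]
  refine ⟨?_, ?_, ?_⟩
  · have h := L.le_opNorm (1, 0, 0); rw [n1, mul_one, Real.norm_eq_abs] at h; exact h
  · have h := L.le_opNorm (0, 1, 0); rw [n2, mul_one, Real.norm_eq_abs] at h; exact h
  · have h := L.le_opNorm (0, 0, 1); rw [n3, mul_one, Real.norm_eq_abs] at h; exact h

end Summit.AtomisticToContinuum.FouriersLaw.Theorems.DrudeDissolution.KineticPolymerGasOnTheTimeAxis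

end
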